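import Literature.Barriers.ABC.BakerMethodBoundsKummerPlaceBoundsProofs
import Literature.Barriers.ABC.BakerMethodBoundsKummerArchProofs
import Literature.Barriers.ABC.BakerMethodBoundsStewartYu1991LineProofs
import HarnessLib

/-!
# Proofs for `BakerMethodBounds`, VII-C: the Kummer second regime with the large primes GROUPED at a free threshold

`Literature/Barriers/ABC/BakerMethodBoundsKummerPlaceBoundsThmTwoProofs.lean` — sequel to
`BakerMethodBoundsKummerPlaceBoundsRegimeTwoProofs.lean` (theorems only; no definition, no named fact).
That file runs the `2`-Kummer descent of Stewart–Yu's second regime at the FIXED threshold `τ = R^{1/4}`, where at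
most three primes of `bc` are large, so that only the constants `Cw(2), Cw(3), Cw(4)` of the archimedean binder `hW₂`
(shape of `Literature.NumberTheory.Transcendental.Waldschmidt1980.waldschmidt1980_hW₂`) occur — enough for Theorem 1
(`log c ≪ G^{1/3} (log G)³`).  For Theorem 2 of [cite: StewartYu2001, Theorem 2]
(`log z < p′ · G^{c log₃ G⋆ / log₂ G}`, `p′ = min P`) the threshold must move with the triple (`T = G^{s(G)}`,
`s(G) = log₃ G⋆ / log₂ G`), and the number `n` of primes of `bc` above `T` is free (`T^n ≤ G`).  This file re-runs the
same deduction with the threshold `T ≥ 1` a PARAMETER and the set `L = {q ∣ bc : q > T}` of large primes of any size: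

* `neg_log_sub_log_le_kummer₂_placeBounds_grouped` — for an abc triple with `ab > 1`, either every prime of `c` is
  `≤ T` (then `log c ≤ ω(c) Θ_{ab} · 3TY` by `log_le_of_primes_le_placeBounds`), or, with `n = #L ≥ 1` and
  `T^n ≤ G`: `−log log(c/b) ≤ 348 · C(n+1) · 2^{n+2} · Λ^n · Q³ · Y²`, `Q = ω M T Λ`, where `ω = ω(abc)`,
  `M = K^{ω+1} ∏_{q ∣ abc} log max(4, q)` (`≥ Θ_{ab}, Θ_{ac}`), `Λ = max(1, log G)`, `Y = log max(e, 2 log c)` and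
  `C` is ANY monotone majorant `≥ 1` of the constants `Cw`.

The proof is that of `log_le_of_sq_lt_kummer₂_placeBounds` line by line (`c/b = β · ∏_{q ∈ L} q^{e_q}` with `β` the
`T`-smooth part, `β = β₀^{2ʲ}` with `β₀` not a square, Kummer independence of `{q ∈ L} ∪ {β₀}` by
`kummer_arch_lower_bound₂` / `kummer_arch_lower_bound_primes₂`, `h(β)` paid `p`-adically at the small primes by
`logHeight₁_smooth_le_placeBounds`), with the bookkeeping `n ≤ 3`, `Cw(n) ≤ max Cw(2..4)` replaced by the majorant
`C(n+1)` and cruder absorptions (`log x ≤ x`).  It is the archimedean step of the door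
`stewartYu2001_thm2_of_placeBounds_kummerArchBound₂`
(`Literature/NumberTheory/DiophantineGeometry/AbcStewartYu2001KummerPlaceBoundsProofs.lean`), which takes
`T = G^{s(G)}` and absorbs `C(n+1) 2^{n+2} Λ^n` using `n ≤ log G / log T = log₂ G / log₃ G⋆` and a growth hypothesis
`Cw(n) ≤ (c₀ n)^n`.  No new mathematics. [cite: StewartYu2001, Theorem 2 (proof), as reconstructed]
[cite: Waldschmidt1980, Prop. 3.8]

## References

* [StewartYu2001] C. L. Stewart, K. Yu, *On the abc conjecture, II*, Duke Math. J. 108 (2001), 169–181 — Theorem 2, §3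
  (cite-only in the tree; the deduction is reconstructed, cf. `AbcStewartYu2001.lean`).
* [StewartYu1991] C. L. Stewart, K. Yu, *On the abc conjecture*, Math. Ann. 291 (1991), 225–230 — p. 229 (the
  archimedean form `Λ = log(c/b) = log(1 + a/b)`, grouped use of the linear-forms estimate).
* [Waldschmidt1980] M. Waldschmidt, Acta Arith. 37 (1980) — Prop. 3.8.
-/

noncomputable section

open Finset Real Height Polynomial IntermediateField
open Literature.NumberTheory.DiophantineGeometry
open Literature.NumberTheory.DiophantineGeometry.Dioph
open Literature.NumberTheory.DiophantineGeometry.Pasten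

namespace Literature.Barriers.ABC

section GroupedKummerPlaceBounds

variable {K : ℝ} {a b c : ℕ}

/-- `Θ_{uv} = theta K u v 0 = K^{ω(uv)+1} ∏_{q ∣ uv} log q ≤ K^{ω(n)+1} ∏_{q ∣ n} log max(4, q)` whenever
`uv ∣ n` (`u, v` coprime and non-zero, `n ≠ 0`, `K ≥ 1`). [folklore] -/
private theorem theta_zero_le_M (hK : 1 ≤ K) {u v n : ℕ} (hu : u ≠ 0) (hv : v ≠ 0) (huv : u.Coprime v)
    (hn : n ≠ 0) (hdvd : u * v ∣ n) :
    theta K u v 0 ≤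
      K ^ (n.primeFactors.card + 1) * ∏ q ∈ n.primeFactors, Real.log ((max 4 q : ℕ) : ℝ) := by
  rw [theta_zero_eq K hu hv huv]
  have hsub : (u * v).primeFactors ⊆ n.primeFactors := Nat.primeFactors_mono hdvd hn
  have hK0 : 0 ≤ K := by linarith
  have h1 : K ^ ((u * v).primeFactors.card + 1) ≤ K ^ (n.primeFactors.card + 1) :=
    pow_le_pow_right₀ hK (by have := Finset.card_le_card hsub; omega)
  have hlog0 : ∀ q ∈ (u * v).primeFactors, 0 ≤ Real.log (q : ℝ) := fun q hq =>
    Real.log_nonneg (by exact_mod_cast (Nat.prime_of_mem_primeFactors hq).one_lt.le)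
  have hpos4 : ∀ q : ℕ, 0 < Real.log ((max 4 q : ℕ) : ℝ) := fun q =>
    Real.log_pos (by exact_mod_cast lt_of_lt_of_le (by norm_num : 1 < 4) (le_max_left 4 q))
  have hone4 : ∀ q : ℕ, 1 ≤ Real.log ((max 4 q : ℕ) : ℝ) := fun q => by
    rw [← Real.log_exp 1]
    apply Real.log_le_log (Real.exp_pos 1)
    have h4 : (4 : ℝ) ≤ ((max 4 q : ℕ) : ℝ) := by exact_mod_cast le_max_left 4 q
    have := Real.exp_one_lt_d9
    linarith
  have h2 : ∏ q ∈ (u * v).primeFactors, Real.log (q : ℝ) ≤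
      ∏ q ∈ (u * v).primeFactors, Real.log ((max 4 q : ℕ) : ℝ) := by
    apply Finset.prod_le_prod hlog0
    intro q hq
    have hq0 : (0 : ℝ) < q := by exact_mod_cast (Nat.prime_of_mem_primeFactors hq).pos
    exact Real.log_le_log hq0 (by exact_mod_cast le_max_right 4 q)
  have h3 : ∏ q ∈ (u * v).primeFactors, Real.log ((max 4 q : ℕ) : ℝ) ≤
      ∏ q ∈ n.primeFactors, Real.log ((max 4 q : ℕ) : ℝ) :=
    Finset.prod_le_prod_of_subset_of_one_le hsub (fun q _ => (hpos4 q).le) fun q _ _ => hone4 q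
  exact mul_le_mul h1 (h2.trans h3) (Finset.prod_nonneg hlog0) (pow_nonneg hK0 _)

set_option maxHeartbeats 800000 in
/-- **Second regime, Kummer version, with the large primes grouped at a free threshold `T`.** For an abc triple
`(a, b, c)` with `ab > 1`, `K ≥ 1`, the two `p`-adic place bounds, the `E = 2` Kummer-conditional archimedean binder
`hW₂` with constants `Cw(n) ≥ 0` bounded by a monotone majorant `C(n) ≥ 1`, and a real `T ≥ 1`: with
`ω = ω(abc)`, `M = K^{ω+1} ∏_{q ∣ abc} log max(4, q)`, `G = rad(abc)`, `Λ = max(1, log G)`,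
`Y = log max(e, 2 log c)`, `Q = ω M T Λ` — EITHER every prime of `c` is `≤ T`, OR there is `n ≥ 1` (the number of primes
of `bc` above `T`) with `T^n ≤ G` and
`−log(log c − log b) ≤ 348 · C(n+1) · 2^{n+2} · Λ^n · Q³ · Y²`.
Proof (= `log_le_of_sq_lt_kummer₂_placeBounds` with `τ := T`, `#L` free): `c/b = β ∏_{q ∈ L} q^{e_q}`, `β` the
`T`-smooth part, `|e_q| ≤ 1 + 3 log c`; if `β = 1` the bound for the primes of `L` alone
(`kummer_arch_lower_bound_primes₂`); else `β = β₀^{2ʲ}` with `β₀` not a square (`exists_eq_pow_two_pow_of_pos`),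
a unit at `L`, `h(β₀) ≤ h(β) ≤ #S (Θ_{ab} + Θ_{ac}) 3TY ≤ 6 ω M T Y` (`logHeight₁_smooth_le_placeBounds`),
`2ʲ ≤ 2 h(β)`, and `kummer_arch_lower_bound₂` on the `n + 1` generators `{q ∈ L} ∪ {β₀}`; the logarithms are
absorbed by `log x ≤ x`. [cite: StewartYu2001, Theorem 2 (proof), as reconstructed]
[cite: StewartYu1991, p. 229] [cite: Waldschmidt1980, Prop 3.8 (p. 274)] -/
theorem neg_log_sub_log_le_kummer₂_placeBounds_grouped (hK : 1 ≤ K)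
    (hpad : ∀ {a b c : ℕ}, IsABCTriple a b c → ∀ {p : ℕ}, p.Prime → p ∣ a →
      (a.factorization p : ℝ) * Real.log p < theta K b c 0 *
        ((p / Real.log p) * (Real.log p + Real.log (max (Real.exp 1) (2 * Real.log c)))))
    (hpadc : ∀ {a b c : ℕ}, IsABCTriple a b c → 1 < a * b → ∀ {p : ℕ}, p.Prime → p ∣ c →
      (c.factorization p : ℝ) * Real.log p < theta K a b 0 *
        ((p / Real.log p) * (Real.log p + Real.log (max (Real.exp 1) (2 * Real.log c)))))
    (Cw : ℕ → ℝ) (hCw : ∀ n, 0 ≤ Cw n)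
    (hW₂ : ∀ (n : ℕ) (α : Fin (n + 1) → ℚ) (b : Fin (n + 1) → ℤ) (V : Fin (n + 1) → ℝ) (W : ℝ),
      (∀ j, 0 < α j ∧ α j ≠ 1) →
      Module.finrank ℚ ↥(IntermediateField.adjoin ℚ
          (Set.range fun j => Real.sqrt (α j : ℝ))) = 2 ^ (n + 1) →
      Monotone V → 1 ≤ V 0 →
      (∀ j, max (logHeight₁ (α j)) |Real.log (α j : ℝ)| ≤ V j) →
      0 < W → (∀ j, logHeight₁ (b j : ℚ) ≤ W) →
      ∑ j, (b j : ℝ) * Real.log (α j : ℝ) ≠ 0 →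
      Real.exp (-(Cw (n + 1) * (∏ j, V j) * (W + Real.log (2 * V (Fin.last n))) *
          Real.log (2 * (if n = 0 then 1 else V ⟨n - 1, by omega⟩)) / Real.log 2 ^ (n + 2))) <
        |∑ j, (b j : ℝ) * Real.log (α j : ℝ)|)
    (Cb : ℕ → ℝ) (hCb1 : ∀ n, 1 ≤ Cb n) (hCbmono : Monotone Cb) (hCwCb : ∀ n, Cw n ≤ Cb n)
    (h : IsABCTriple a b c) (h1 : 1 < a * b) {T : ℝ} (hT : 1 ≤ T) :
    (∀ q ∈ c.primeFactors, (q : ℝ) ≤ T) ∨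
    ∃ n : ℕ, 1 ≤ n ∧ T ^ n ≤ (rad a b c : ℝ) ∧
      -Real.log (Real.log c - Real.log b) ≤
        348 * Cb (n + 1) * 2 ^ (n + 2) * max 1 (Real.log (rad a b c : ℕ)) ^ n *
          (((a * b * c).primeFactors.card : ℝ) *
            (K ^ ((a * b * c).primeFactors.card + 1) *
              ∏ q ∈ (a * b * c).primeFactors, Real.log ((max 4 q : ℕ) : ℝ)) * T *
            max 1 (Real.log (rad a b c : ℕ))) ^ 3 *
          Real.log (max (Real.exp 1) (2 * Real.log c)) ^ 2 := by
  classical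
  obtain ⟨ha, hb, habc, hcop⟩ := id h
  have hc : c ≠ 0 := by omega
  have hbc : b.Coprime c := coprime_right_of_isABCTriple h
  have hcb : c.Coprime b := hbc.symm
  have hac : a.Coprime c := coprime_left_of_isABCTriple h
  have habc0 : a * b * c ≠ 0 := by positivity
  have hK0 : 0 ≤ K := zero_le_one.trans hK
  have hb_r : (0 : ℝ) < b := by exact_mod_cast hb
  have hc_r : (0 : ℝ) < c := by exact_mod_cast Nat.pos_of_ne_zero hc
  have hbc_lt : (b : ℝ) < c := by exact_mod_cast (show b < c by omega)
  have hT0 : 0 ≤ T := zero_le_one.trans hT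
  -- notation
  set R : ℕ := rad a b c with hRdef
  have hR0n : R ≠ 0 := by
    rw [hRdef, rad_def]; exact UniqueFactorizationMonoid.radical_ne_zero
  have hR1 : (1 : ℝ) ≤ (R : ℝ) := one_le_rad_real a b c
  have hR0 : (0 : ℝ) < R := by linarith
  set Λ : ℝ := max 1 (Real.log (R : ℝ)) with hΛdef
  have hΛ1 : 1 ≤ Λ := le_max_left _ _
  have hΛ0 : 0 < Λ := by linarith
  set y : ℝ := Real.log c with hydef
  have hy0 : 0 < y := Real.log_pos (by exact_mod_cast (show 1 < c by omega))
  set Y : ℝ := Real.log (max (Real.exp 1) (2 * Real.log c)) with hYdef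
  have hY1 : 1 ≤ Y := one_le_log_max_exp _
  have hY0 : 0 < Y := by linarith
  set ω : ℕ := (a * b * c).primeFactors.card with hωdef
  set PL : ℝ := ∏ q ∈ (a * b * c).primeFactors, Real.log ((max 4 q : ℕ) : ℝ) with hPLdef
  set M : ℝ := K ^ (ω + 1) * PL with hMdef
  have hPL1 : 1 ≤ PL := one_le_prod_log_max_four _
  have hM1 : 1 ≤ M := one_le_mul_of_one_le_of_one_le (one_le_pow₀ hK) hPL1
  have hM0 : 0 < M := by linarith
  have hω1 : (1 : ℝ) ≤ ω := by
    have h1' : 1 < a * b * c := lt_of_lt_of_le h1 (Nat.le_mul_of_pos_right _ (Nat.pos_of_ne_zero hc))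
    exact_mod_cast Finset.card_pos.mpr (Nat.nonempty_primeFactors.mpr h1')
  have hω0 : (0 : ℝ) < ω := by linarith
  have hΘab : theta K a b 0 ≤ M := theta_zero_le_M hK ha.ne' hb.ne' hcop habc0 (Dvd.intro c rfl)
  have hΘac : theta K a c 0 ≤ M := theta_zero_le_M hK ha.ne' hc hac habc0 (Dvd.intro b (by ring))
  have hΘab0 : 0 ≤ theta K a b 0 := theta_nonneg hK0 a b 0
  have hΘac0 : 0 ≤ theta K a c 0 := theta_nonneg hK0 a c 0
  set Q : ℝ := (ω : ℝ) * M * T * Λ with hQdef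
  have hQ1 : 1 ≤ Q := one_le_mul_of_one_le_of_one_le
    (one_le_mul_of_one_le_of_one_le (one_le_mul_of_one_le_of_one_le hω1 hM1) hT) hΛ1
  have hQ0 : 0 < Q := by linarith
  have hΛQ : Λ ≤ Q := by
    have : Λ = 1 * 1 * 1 * Λ := by ring
    rw [this, hQdef]
    exact mul_le_mul_of_nonneg_right (mul_le_mul (mul_le_mul hω1 hM1 zero_le_one hω0.le) hT
      zero_le_one (mul_nonneg hω0.le hM0.le)) hΛ0.le
  -- primes of `cb`, small and large
  set P : Finset ℕ := (c * b).primeFactors with hPdef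
  have hcbdvd : c * b ∣ a * b * c := Dvd.intro_left a (by ring)
  have hPsub : P ⊆ (a * b * c).primeFactors := Nat.primeFactors_mono hcbdvd habc0
  have hPprime : ∀ q ∈ P, q.Prime := fun q hq => Nat.prime_of_mem_primeFactors hq
  have hcardP : P.card ≤ ω := Finset.card_le_card hPsub
  set S : Finset ℕ := P.filter (fun q => (q : ℝ) ≤ T) with hSdef
  set L : Finset ℕ := P.filter (fun q => ¬(q : ℝ) ≤ T) with hLdef
  have hSsub : S ⊆ P := Finset.filter_subset _ _
  have hLsub : L ⊆ P := Finset.filter_subset _ _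
  have hSτ : ∀ q ∈ S, (q : ℝ) ≤ T := fun q hq => (Finset.mem_filter.mp hq).2
  have hLτ : ∀ q ∈ L, T < q := fun q hq => lt_of_not_ge (Finset.mem_filter.mp hq).2
  have hLprime : ∀ q ∈ L, q.Prime := fun q hq => hPprime q (hLsub hq)
  have hcardS : (S.card : ℝ) ≤ ω := by exact_mod_cast (Finset.card_le_card hSsub).trans hcardP
  -- `log q ≤ Λ` on `P`
  have hlogP : ∀ q ∈ P, Real.log q ≤ Λ := by
    intro q hq
    have hqp := hPprime q hq
    have hqR : (q : ℝ) ≤ R := by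
      exact_mod_cast prime_le_rad hqp ((Nat.dvd_of_mem_primeFactors hq).trans hcbdvd) habc0
    exact (Real.log_le_log (by exact_mod_cast hqp.pos) hqR).trans (le_max_right _ _)
  rcases Finset.eq_empty_or_nonempty L with hLe | hLne
  · -- every prime of `cb` is small
    left
    intro q hq
    have hqP : q ∈ P := Nat.primeFactors_mono (Dvd.intro b rfl) (mul_ne_zero hc hb.ne') hq
    by_contra hqτ
    have : q ∈ L := Finset.mem_filter.mpr ⟨hqP, hqτ⟩
    rw [hLe] at this
    exact Finset.notMem_empty q this
  right
  set n : ℕ := L.card with hndef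
  have hn1 : 1 ≤ n := hLne.card_pos
  refine ⟨n, hn1, ?_, ?_⟩
  · -- `T^n ≤ ∏_{q ∈ L} q ≤ G`
    have h1' : ∏ q ∈ L, q ∣ ∏ q ∈ (a * b * c).primeFactors, q :=
      Finset.prod_dvd_prod_of_subset _ _ _ (hLsub.trans hPsub)
    rw [← Nat.radical_eq_prod_primeFactors, ← rad_def] at h1'
    have hle : ∏ q ∈ L, q ≤ R :=
      Nat.le_of_dvd (by rw [hRdef, rad_def]; exact Nat.radical_pos _) h1'
    calc T ^ n = ∏ _q ∈ L, T := by rw [Finset.prod_const]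
      _ ≤ ∏ q ∈ L, (q : ℝ) := Finset.prod_le_prod (fun _ _ => hT0) fun q hq => (hLτ q hq).le
      _ = ((∏ q ∈ L, q : ℕ) : ℝ) := by push_cast; rfl
      _ ≤ R := by exact_mod_cast hle
  -- the smooth part `β` and the splitting of `c/b`
  set e : ℕ → ℤ := expDiff c b with hedef
  set β : ℚ := ∏ q ∈ S, (q : ℚ) ^ e q with hβdef
  have hβpos : 0 < β := Finset.prod_pos fun q hq =>
    zpow_pos (by exact_mod_cast (hPprime q (hSsub hq)).pos) _
  have hsplitQ : (c : ℚ) / b = β * ∏ q ∈ L, (q : ℚ) ^ e q := by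
    rw [cast_div_eq_prod_zpow hc hb.ne' hcb, hβdef, hSdef, hLdef,
      Finset.prod_filter_mul_prod_filter_not]
  set Λ₀ : ℝ := Real.log c - Real.log b with hΛ₀def
  have hΛ₀eq : Λ₀ = Real.log (β : ℝ) + ∑ q ∈ L, (e q : ℝ) * Real.log q := by
    have hcast : (((c : ℚ) / b : ℚ) : ℝ) = (c : ℝ) / b := by push_cast; rfl
    have hq0 : ∀ q ∈ L, ((q : ℝ)) ^ e q ≠ 0 := fun q hq =>
      zpow_ne_zero _ (by exact_mod_cast (hLprime q hq).ne_zero)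
    have h2 : (((c : ℚ) / b : ℚ) : ℝ) = (β : ℝ) * ∏ q ∈ L, (q : ℝ) ^ e q := by
      rw [hsplitQ]; push_cast; rfl
    have hβr : (β : ℝ) ≠ 0 := by exact_mod_cast hβpos.ne'
    have hprod0 : ∏ q ∈ L, (q : ℝ) ^ e q ≠ 0 := Finset.prod_ne_zero_iff.mpr hq0
    calc Λ₀ = Real.log ((c : ℝ) / b) := (Real.log_div hc_r.ne' hb_r.ne').symm
      _ = Real.log ((β : ℝ) * ∏ q ∈ L, (q : ℝ) ^ e q) := by rw [← hcast, h2]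
      _ = Real.log (β : ℝ) + ∑ q ∈ L, Real.log ((q : ℝ) ^ e q) := by
          rw [Real.log_mul hβr hprod0, Real.log_prod hq0]
      _ = Real.log (β : ℝ) + ∑ q ∈ L, (e q : ℝ) * Real.log q := by
          congr 1
          exact Finset.sum_congr rfl fun q _ => Real.log_zpow _ _
  -- `0 < Λ₀`
  have hΛ₀pos : 0 < Λ₀ := by
    rw [hΛ₀def]; linarith only [Real.log_lt_log hb_r hbc_lt]
  -- exponents: `|e_q| ≤ 1 + 3y`
  set Bₑ : ℝ := 1 + 3 * y with hBₑdef
  have hBₑ1 : 1 ≤ Bₑ := by rw [hBₑdef]; linarith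
  have hBₑ : ∀ q ∈ L, (|e q| : ℝ) ≤ Bₑ := by
    intro q hq
    have hqp := hLprime q hq
    have hnat : (|e q| : ℝ) = ((expDiff c b q).natAbs : ℝ) := by
      rw [Nat.cast_natAbs, Int.cast_abs]
    rw [hnat, natAbs_expDiff hc hb.ne' hcb q]
    have h1' := factorization_le_log (mul_ne_zero hc hb.ne') hqp
    have h2 : Real.log ((c * b : ℕ) : ℝ) ≤ 2 * y := by
      push_cast
      rw [Real.log_mul hc_r.ne' hb_r.ne', hydef]
      linarith only [Real.log_le_log hb_r hbc_lt.le]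
    have h3 : (0 : ℝ) ≤ y := hy0.le
    rw [hBₑdef]; linarith only [h1', h2, h3]
  have hlogBₑ : Real.log (Real.exp 1 * Bₑ) ≤ 4 * Y := by
    rw [hBₑdef, hYdef]; exact log_exp_mul_le_four_mul hy0.le
  have he2 : (2 : ℝ) ≤ Real.exp 1 := by have := Real.add_one_le_exp (1 : ℝ); linarith
  have hlogBₑ0 : 0 ≤ Real.log (Real.exp 1 * Bₑ) :=
    Real.log_nonneg (one_le_mul_of_one_le_of_one_le (by linarith) hBₑ1)
  -- elementary absorptions
  have hlog2 : 0 < Real.log 2 := Real.log_pos one_lt_two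
  have hinv : ∀ k : ℕ, 1 / Real.log 2 ^ k ≤ 2 ^ k := fun k => inv_log_two_pow_le _
  have hlog2Λ : Real.log (2 * Λ) ≤ 2 * Λ := log_two_mul_le hΛ1
  have hlog2Λ0 : 0 ≤ Real.log (2 * Λ) := Real.log_nonneg (by linarith)
  have hCbn : Cb n ≤ Cb (n + 1) := hCbmono (Nat.le_succ n)
  have hCb0 : 0 ≤ Cb (n + 1) := zero_le_one.trans (hCb1 _)
  have hΛn0 : 0 ≤ Λ ^ n := pow_nonneg hΛ0.le n
  -- the target
  set F : ℝ := 348 * Cb (n + 1) * 2 ^ (n + 2) * Λ ^ n * Q ^ 3 with hFdef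
  have hFY : 348 * Cb (n + 1) * 2 ^ (n + 2) * max 1 (Real.log (rad a b c : ℕ)) ^ n *
      (((a * b * c).primeFactors.card : ℝ) *
        (K ^ ((a * b * c).primeFactors.card + 1) *
          ∏ q ∈ (a * b * c).primeFactors, Real.log ((max 4 q : ℕ) : ℝ)) * T *
        max 1 (Real.log (rad a b c : ℕ))) ^ 3 *
      Real.log (max (Real.exp 1) (2 * Real.log c)) ^ 2 = F * Y ^ 2 := by
    rw [hFdef, hQdef, hMdef, hPLdef, hωdef, hΛdef, hRdef, hYdef]
  rw [hFY]
  rcases eq_or_ne β 1 with hβ1 | hβ1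
  · -- `β = 1`: the primes of `L` alone
    have hΛ₀eq' : Λ₀ = ∑ q ∈ L, (e q : ℝ) * Real.log q := by
      rw [hΛ₀eq, hβ1]; push_cast; rw [Real.log_one, zero_add]
    have hne : ∑ q ∈ L, (e q : ℝ) * Real.log q ≠ 0 := by rw [← hΛ₀eq']; exact hΛ₀pos.ne'
    have key := kummer_arch_lower_bound_primes₂ Cw hCw hW₂ L hLprime hn1 e hΛ1
      (fun q hq => hlogP q (hLsub hq)) hBₑ1 hBₑ hne
    rw [← hΛ₀eq', abs_of_pos hΛ₀pos] at key
    -- `−log Λ₀ < Cw(n) Λ^n (log(eBₑ) + log 2Λ) log 2Λ / (log 2)^{n+1} ≤ 6 C(n+1) 2^{n+2} Λ^{n+2} Y`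
    have hCn : Cw n ≤ Cb (n + 1) := (hCwCb n).trans hCbn
    have hCn0 : 0 ≤ Cw n := hCw _
    have hsum : Real.log (Real.exp 1 * Bₑ) + Real.log (2 * Λ) ≤ 6 * Λ * Y := by
      have h1' : 2 * Λ ≤ 2 * Λ * Y := le_mul_of_one_le_right (by linarith) hY1
      have h2' : Y ≤ Λ * Y := le_mul_of_one_le_left (by linarith) hΛ1
      have h3' : 6 * Λ * Y = 2 * Λ * Y + 4 * (Λ * Y) := by ring
      linarith only [h1', h2', h3', hlogBₑ, hlog2Λ]
    have hsum0 : 0 ≤ Real.log (Real.exp 1 * Bₑ) + Real.log (2 * Λ) := add_nonneg hlogBₑ0 hlog2Λ0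
    have h6ΛY : 0 ≤ 6 * Λ * Y := mul_nonneg (mul_nonneg (by norm_num) hΛ0.le) hY0.le
    have hP1 : 0 ≤ Cb (n + 1) * Λ ^ n := mul_nonneg hCb0 hΛn0
    have hP2 : 0 ≤ Cb (n + 1) * Λ ^ n * (6 * Λ * Y) := mul_nonneg hP1 h6ΛY
    have hP3 : 0 ≤ Cb (n + 1) * Λ ^ n * (6 * Λ * Y) * (2 * Λ) :=
      mul_nonneg hP2 (by linarith only [hΛ0])
    have h' : Cw n * Λ ^ n * (Real.log (Real.exp 1 * Bₑ) + Real.log (2 * Λ)) *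
        Real.log (2 * Λ) / Real.log 2 ^ (n + 1) ≤
        Cb (n + 1) * Λ ^ n * (6 * Λ * Y) * (2 * Λ) * 2 ^ (n + 1) := by
      rw [div_eq_mul_one_div]
      apply mul_le_mul _ (hinv _) (by positivity) hP3
      apply mul_le_mul _ hlog2Λ hlog2Λ0 hP2
      exact mul_le_mul (mul_le_mul_of_nonneg_right hCn hΛn0) hsum hsum0 hP1
    have h'' : Cb (n + 1) * Λ ^ n * (6 * Λ * Y) * (2 * Λ) * 2 ^ (n + 1) =
        6 * Cb (n + 1) * 2 ^ (n + 2) * Λ ^ n * (Λ ^ 2 * Y) := by ring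
    -- `Λ² Y ≤ Q³ Y²`
    have hΛ2 : Λ ^ 2 * Y ≤ Q ^ 3 * Y ^ 2 := by
      have h1' : Λ ^ 2 ≤ Q ^ 2 := pow_le_pow_left₀ hΛ0.le hΛQ 2
      have h2' : Q ^ 2 ≤ Q ^ 3 := pow_le_pow_right₀ hQ1 (by norm_num)
      have h3' : Y ≤ Y ^ 2 := by
        have := mul_le_mul_of_nonneg_left hY1 hY0.le
        nlinarith only [this]
      exact mul_le_mul (h1'.trans h2') h3' hY0.le (pow_nonneg hQ0.le 3)
    have h6 : 6 * Cb (n + 1) * 2 ^ (n + 2) * Λ ^ n * (Λ ^ 2 * Y) ≤ F * Y ^ 2 := by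
      rw [hFdef]
      have hX : 0 ≤ Cb (n + 1) * 2 ^ (n + 2) * Λ ^ n :=
        mul_nonneg (mul_nonneg hCb0 (pow_nonneg zero_le_two _)) hΛn0
      have hΛ2Y : 0 ≤ Λ ^ 2 * Y := mul_nonneg (pow_nonneg hΛ0.le 2) hY0.le
      calc 6 * Cb (n + 1) * 2 ^ (n + 2) * Λ ^ n * (Λ ^ 2 * Y)
          = 6 * (Cb (n + 1) * 2 ^ (n + 2) * Λ ^ n) * (Λ ^ 2 * Y) := by ring
        _ ≤ 348 * (Cb (n + 1) * 2 ^ (n + 2) * Λ ^ n) * (Q ^ 3 * Y ^ 2) :=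
            mul_le_mul (mul_le_mul_of_nonneg_right (by norm_num) hX) hΛ2 hΛ2Y
              (mul_nonneg (by norm_num) hX)
        _ = 348 * Cb (n + 1) * 2 ^ (n + 2) * Λ ^ n * Q ^ 3 * Y ^ 2 := by ring
    linarith only [key, h', h'', h6]
  · -- `β ≠ 1`: the archimedean bound with generators `L ∪ {β₀}`, `β = β₀^{2ʲ}`
    obtain ⟨β₀, j, hβ₀pos, hβ₀1, hβ₀sq, hββ₀⟩ := exists_eq_pow_two_pow_of_pos hβpos hβ1
    -- `log β = 2ʲ log β₀`
    have hlogβ : Real.log (β : ℝ) = ((2 ^ j : ℕ) : ℤ) * Real.log (β₀ : ℝ) := by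
      rw [hββ₀, Rat.cast_pow, Real.log_pow]; push_cast; ring
    have hne : ((2 ^ j : ℕ) : ℤ) * Real.log (β₀ : ℝ) + ∑ q ∈ L, (e q : ℝ) * Real.log q ≠ 0 := by
      have : (((2 ^ j : ℕ) : ℤ) : ℝ) * Real.log (β₀ : ℝ) = Real.log (β : ℝ) := by
        rw [hlogβ]
      rw [this, ← hΛ₀eq]; exact hΛ₀pos.ne'
    -- `β₀` is a unit at the large primes
    have hν : ∀ p ∈ L, padicValRat p β₀ = 0 := by
      intro p hp
      have hpp : p.Prime := hLprime p hp
      haveI : Fact p.Prime := ⟨hpp⟩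
      have hpS : p ∉ S := fun hpS => (not_le.mpr (hLτ p hp)) (hSτ p hpS)
      have hvβ : padicValRat p β = 0 := by
        rw [hβdef, padicValRat_finset_prod p S _ (fun q hq =>
          zpow_ne_zero _ (by exact_mod_cast (hPprime q (hSsub hq)).ne_zero))]
        refine Finset.sum_eq_zero fun q hq => ?_
        have hqp : q.Prime := hPprime q (hSsub hq)
        haveI : Fact q.Prime := ⟨hqp⟩
        have hpq : p ≠ q := fun h => hpS (h ▸ hq)
        rw [padicValRat.zpow, padicValRat.of_nat, padicValNat_primes hpq]
        simp
      rw [hββ₀, padicValRat.pow] at hvβ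
      rcases mul_eq_zero.mp hvβ with h0 | h0
      · exact absurd h0 (by positivity)
      · exact h0
    -- heights: `h(β₀) ≤ h(β) ≤ 6 ω M T Y ≤ 6 Q Y`, `2ʲ ≤ 2 h(β)`
    have hhβ := logHeight₁_smooth_le_placeBounds hK hpad hpadc h h1 S hSsub hSτ
    have h6 : logHeight₁ β ≤ 6 * Q * Y := by
      calc logHeight₁ β ≤ S.card * ((theta K a b 0 + theta K a c 0) * (3 * T * Y)) := hhβ
        _ ≤ ω * ((M + M) * (3 * T * Y)) := by
            apply mul_le_mul hcardS _ (by positivity) hω0.le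
            exact mul_le_mul_of_nonneg_right (add_le_add hΘab hΘac) (by positivity)
        _ = 6 * ((ω : ℝ) * M * T * 1) * Y := by ring
        _ ≤ 6 * ((ω : ℝ) * M * T * Λ) * Y := by
            apply mul_le_mul_of_nonneg_right _ hY0.le
            apply mul_le_mul_of_nonneg_left _ (by norm_num)
            exact mul_le_mul_of_nonneg_left hΛ1 (by positivity)
        _ = 6 * Q * Y := by rw [hQdef]
    have h60 : 0 ≤ 6 * Q * Y := by positivity
    have hh0 : 0 ≤ logHeight₁ β := zero_le_logHeight₁ _
    have hββ₀h : logHeight₁ β = (2 ^ j : ℕ) * logHeight₁ β₀ := by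
      rw [hββ₀, logHeight₁_pow]
    have hh₀pos : Real.log 2 ≤ logHeight₁ β₀ := log_two_le_logHeight₁ hβ₀pos hβ₀1
    have hlog2' : (1 / 2 : ℝ) < Real.log 2 := by have := Real.log_two_gt_d9; linarith
    have h2j : ((2 ^ j : ℕ) : ℝ) ≤ 2 * logHeight₁ β := by
      rw [hββ₀h]
      have h0 : (0 : ℝ) ≤ (2 ^ j : ℕ) := by positivity
      have h1' : (1 / 2 : ℝ) ≤ logHeight₁ β₀ := hlog2'.le.trans hh₀pos
      have h2 := mul_le_mul_of_nonneg_left h1' h0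
      linarith only [h2]
    have hh₀le : logHeight₁ β₀ ≤ logHeight₁ β := by
      rw [hββ₀h]
      have h1' : (1 : ℝ) ≤ (2 ^ j : ℕ) := by exact_mod_cast Nat.one_le_two_pow
      exact le_mul_of_one_le_left (zero_le_logHeight₁ _) h1'
    -- the coefficients bound `B = Bₑ (1 + 2 h(β))`
    set B : ℝ := Bₑ * (1 + 2 * logHeight₁ β) with hBdef
    have hB1' : 1 ≤ 1 + 2 * logHeight₁ β := by linarith
    have hB1 : 1 ≤ B := one_le_mul_of_one_le_of_one_le hBₑ1 hB1'
    have hBₑB : Bₑ ≤ B := le_mul_of_one_le_right (by linarith) hB1'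
    have hBe : ∀ p ∈ L, (|e p| : ℝ) ≤ B := fun p hp => (hBₑ p hp).trans hBₑB
    have hBm : (|((2 ^ j : ℕ) : ℤ)| : ℝ) ≤ B := by
      have : (|((2 ^ j : ℕ) : ℤ)| : ℝ) = ((2 ^ j : ℕ) : ℝ) := by
        push_cast; exact abs_of_nonneg (by positivity)
      rw [this]
      calc ((2 ^ j : ℕ) : ℝ) ≤ 1 + 2 * logHeight₁ β := by linarith
        _ = 1 * (1 + 2 * logHeight₁ β) := (one_mul _).symm
        _ ≤ Bₑ * (1 + 2 * logHeight₁ β) := mul_le_mul_of_nonneg_right hBₑ1 (by linarith)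
    have key := kummer_arch_lower_bound₂ Cw hCw hW₂ L hLprime e hβ₀pos hβ₀1 hβ₀sq hν
      ((2 ^ j : ℕ) : ℤ) hΛ1 (fun q hq => hlogP q (hLsub hq)) hB1 hBe hBm hne
    have hΛ₀eq'' : Λ₀ = (((2 ^ j : ℕ) : ℤ) : ℝ) * Real.log (β₀ : ℝ) +
        ∑ q ∈ L, (e q : ℝ) * Real.log q := by rw [hΛ₀eq, hlogβ]
    rw [← hΛ₀eq'', abs_of_pos hΛ₀pos] at key
    have hCn : Cw (n + 1) ≤ Cb (n + 1) := hCwCb _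
    have hCn0 : 0 ≤ Cw (n + 1) := hCw _
    -- the pieces: `H = max(h(β₀), Λ) ≤ 6 Q Y`, the logarithms `≤ 29 Q Y`
    set H : ℝ := max (logHeight₁ β₀) Λ with hHdef
    have hH1 : 1 ≤ H := hΛ1.trans (le_max_right _ _)
    have hH0 : 0 < H := by linarith
    have hQY1 : 1 ≤ Q * Y := one_le_mul_of_one_le_of_one_le hQ1 hY1
    have h6QY : 0 ≤ 6 * Q * Y := mul_nonneg (mul_nonneg (by norm_num) hQ0.le) hY0.le
    have h29QY : 0 ≤ 29 * Q * Y := mul_nonneg (mul_nonneg (by norm_num) hQ0.le) hY0.le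
    have h2Q : 0 ≤ 2 * Q := by linarith only [hQ0]
    have hHle : H ≤ 6 * Q * Y := by
      refine max_le (hh₀le.trans h6) ?_
      calc Λ ≤ Q := hΛQ
        _ = 1 * Q * 1 := by ring
        _ ≤ 6 * Q * Y := mul_le_mul (mul_le_mul_of_nonneg_right (by norm_num) hQ0.le) hY1
            zero_le_one (mul_nonneg (by norm_num) hQ0.le)
    have hlogB : Real.log (Real.exp 1 * B) ≤ 4 * Y + 13 * Q * Y := by
      have hsplit : Real.exp 1 * B = (Real.exp 1 * Bₑ) * (1 + 2 * logHeight₁ β) := by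
        rw [hBdef]; ring
      have h13 : 1 + 2 * logHeight₁ β ≤ 13 * Q * Y := by linarith only [h6, hQY1]
      have hpos' : (0 : ℝ) < 1 + 2 * logHeight₁ β := by linarith only [hh0]
      have hl : Real.log (1 + 2 * logHeight₁ β) ≤ 13 * Q * Y := by
        have := Real.log_le_sub_one_of_pos hpos'
        linarith only [this, h13]
      have hne1 : Real.exp 1 * Bₑ ≠ 0 := (mul_pos (Real.exp_pos 1) (by linarith only [hBₑ1])).ne'
      rw [hsplit, Real.log_mul hne1 hpos'.ne']
      exact add_le_add hlogBₑ hl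
    have hlog2H : Real.log (2 * H) ≤ 12 * Q * Y := by
      have := Real.log_le_sub_one_of_pos (show (0 : ℝ) < 2 * H by linarith only [hH0])
      linarith only [this, hHle]
    have hsum : Real.log (Real.exp 1 * B) + Real.log (2 * H) ≤ 29 * Q * Y := by
      have h4 : 4 * Y ≤ 4 * (Q * Y) := by
        have := le_mul_of_one_le_left hY0.le hQ1
        linarith only [this]
      linarith only [h4, hlogB, hlog2H]
    have hsum0 : 0 ≤ Real.log (Real.exp 1 * B) + Real.log (2 * H) := by
      have h1' : 0 ≤ Real.log (Real.exp 1 * B) :=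
        Real.log_nonneg (one_le_mul_of_one_le_of_one_le (by linarith only [he2]) hB1)
      have h2' : 0 ≤ Real.log (2 * H) := Real.log_nonneg (by linarith only [hH1])
      exact add_nonneg h1' h2'
    have hP1 : 0 ≤ Cb (n + 1) * (Λ ^ n * (6 * Q * Y)) := mul_nonneg hCb0 (mul_nonneg hΛn0 h6QY)
    have hP2 : 0 ≤ Cb (n + 1) * (Λ ^ n * (6 * Q * Y)) * (29 * Q * Y) := mul_nonneg hP1 h29QY
    have hP3 : 0 ≤ Cb (n + 1) * (Λ ^ n * (6 * Q * Y)) * (29 * Q * Y) * (2 * Q) := mul_nonneg hP2 h2Q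
    have h' : Cw (n + 1) * (Λ ^ n * H) *
        (Real.log (Real.exp 1 * B) + Real.log (2 * H)) * Real.log (2 * Λ) /
        Real.log 2 ^ (n + 2) ≤
        Cb (n + 1) * (Λ ^ n * (6 * Q * Y)) * (29 * Q * Y) * (2 * Q) * 2 ^ (n + 2) := by
      rw [div_eq_mul_one_div]
      apply mul_le_mul _ (hinv _) (by positivity) hP3
      apply mul_le_mul _ (hlog2Λ.trans (by linarith only [hΛQ])) hlog2Λ0 hP2
      apply mul_le_mul _ hsum hsum0 hP1
      exact mul_le_mul hCn (mul_le_mul_of_nonneg_left hHle hΛn0) (mul_nonneg hΛn0 hH0.le) hCb0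
    have h'' : Cb (n + 1) * (Λ ^ n * (6 * Q * Y)) * (29 * Q * Y) * (2 * Q) * 2 ^ (n + 2) =
        F * Y ^ 2 := by rw [hFdef]; ring
    linarith only [h', h'', key]

end GroupedKummerPlaceBounds

end Literature.Barriers.ABC

end
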